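import Mathlib.Analysis.SpecificLimits.Basic
import HarnessLib

/-!
# Weighted sup-norm absorption, abstract core: a self-improving domination under a truncated weight
# (FF5 of plan §6 of the registered sub-goal `t12_logLinearPreimage_and_dipoleModulus`, line `birth`,
# crux `TwoClocks.EquilibriumFastWindowLD`, stmt-AtomisticToContinuum-14440; infrastructure file)

Plan §6 bounds the `ℓ ≥ 2` component `u` of the corrector with LINEAR growth by the weighted sup-norm
scheme of Grad (1963) / Caflisch (1980) / Guo (2010), in the form the tree uses for the quartic weight
(`Literature.Analysis.UnboundedOperators.LinearizedBoltzmannQuarticAbsorption` and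
`…LinearizedBoltzmannPolynomialInverse.exists_abs_le_mul_quartic_of_fixedPoint`): write
`u = 𝒯ᵏ u + r` with the positive `k`-step far-field operator `𝒯ᵏ`; start from an a-priori bound
`|u| ≤ a W'` in a BIG weight `W'` (Gaussian or quartic); make it part of the weight by truncation,
`W_N := W + W'/N`, so that `m_N := sup |u| / W_N ≤ |a| N < ∞`; improve
`|u| ≤ m W_N ⟹ |u| ≤ (μ m + D) W_N` on the far field (`𝒯ᵏ` contracts both weights there, FF3/FF4)
and use `|u| ≤ B W` on the ball; conclude `m_N ≤ μ m_N + max D B`, i.e.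
`m_N ≤ max D B / (1 - μ)` UNIFORMLY in `N`; let `N → ∞`.

This file is the Boltzmann-free real-analysis core of that argument (FF5), stated so that FF6 only
has to supply the self-improving inequality for its concrete operator:

* **`t12_abs_le_weight_of_selfImproving`** (registered helper) — ONE positive weight `W`: if
  `|u| ≤ a W` for some finite a-priori constant `a` and, for every `m ≥ 0`, the domination
  `|u| ≤ m W` improves itself to `|u| ≤ (μ m + D) W` with `μ < 1`, then `|u| ≤ D/(1-μ) · W`
  (the `sSup` device of `exists_abs_le_mul_quartic_of_fixedPoint`, once and for all; no sign
  conditions on `μ`, `D`, `a`).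
* **`t12_abs_le_weight_of_truncated_selfImproving`** (registered helper) — the truncated-weight /
  `N → ∞` wrapper in the shape FF6 consumes: weights `W ≥ 0` (target, e.g. `1 + |v|`) and `W' > 0`
  (a-priori, e.g. `(1 + |v|²)²` or `e^{|v|²/4}`), a far set `S` (e.g. `{s₀ ≤ |v|}`); hypotheses:
  a-priori `|u| ≤ a W'`, near field `|u x| ≤ B W x` for `x ∉ S`, and for every `N ≥ 1`, `m ≥ 0` the
  far-field improvement `(∀ x, |u x| ≤ m (W x + W' x / N)) → ∀ x ∈ S, |u x| ≤ (μ m + D) (W x + W' x / N)`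
  with `0 ≤ μ < 1`, `0 ≤ D`; conclusion: `|u| ≤ max D B / (1 - μ) · W` everywhere.
  The ADDITIVE truncation `W + W'/N` replaces the tree's `max (W, W'/N)` (equivalent up to a factor
  `2`): it is the form a positive LINEAR operator propagates —
  `𝒯ᵏ (m W + (m/N) W') = m 𝒯ᵏ W + (m/N) 𝒯ᵏ W' ≤ μ₁ m W + μ₂ (m/N) W'` — so FF6 closes under
  `max μ₁ μ₂ < 1` with no loss; `abs_le_weight_of_maxTruncated_selfImproving` is the same statement
  for the `max` truncation, for a consumer following the tree literally.

How FF6 instantiates it: `X = ℝ³`, `u = Π_{≥2} ψ`, `W v = 1 + |v|`, `W' v = (1 + |v|²)²` (the a-priori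
bound of `…BirthQuarticPreimage`) or `e^{|v|²/4}`, `S = {s₀ ≤ |v|}`, `B = a · sup_{|v| < s₀} W'`; given the
domination `|u| ≤ m (W + W'/N)` by a RADIAL function, the representation of `𝒯ᵏ u` as an average of
products of circle averages (FF1–FF2), the angular contraction on the sector
`zonalAvg u = dipoleMoment u = 0` (FF3 — a property of `u`, not of the dominating weight, which is why the
improving map is a hypothesis here and not a monotone operator) and the certified number `θ_k < 1` (FF4)
bound `|𝒯ᵏ u|` on `S` by `(θ_k + ε) m (W + W'/N)`; the data terms are `≤ D W`; and `u = 𝒯ᵏ u + r` is the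
far-field improvement. Sources of the scheme: Grad 1963 §4–5; Caflisch, CMP 74 (1980); Guo, ARMA 197
(2010) (weighted `L^∞` absorption) — here as elementary real analysis, no measure theory and no
operators, hence tagged folklore.

NOT here: anything about the Boltzmann operator (FF1–FF4, FF6) or the `k`-step iteration identity.
-/

open Filter Topology

namespace Summit.AtomisticToContinuum.HydrodynamicLimit.Theorems.ClampedCorrectorBirth

/-! ### One weight: the `sSup` absorption -/

/-- **Weighted sup-norm absorption, one positive weight** (FF5 core, registered helper). Let `W > 0`
on a type `X` and `u : X → ℝ` with a finite a-priori bound `|u| ≤ a W`. If for every `m ≥ 0` the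
domination `∀ x, |u x| ≤ m W x` improves itself to `∀ x, |u x| ≤ (μ m + D) W x`, with `μ < 1`, then
`|u x| ≤ D / (1 - μ) · W x` for every `x`. Proof: `m := sup |u|/W ≤ a` is finite and `≥ 0`, the
domination holds with it, so `m ≤ μ m + D`. This is the absorption step of the Grad 1963 / Guo 2010
weighted `L^∞` scheme, cf. the tree's `exists_abs_le_mul_quartic_of_fixedPoint` (`μ = 3/4`).
[folklore] -/
theorem t12_abs_le_weight_of_selfImproving : ∀ {X : Type*} (u W : X → ℝ) (μ D a : ℝ), μ < 1 → (∀ x, 0 < W x) → (∀ x, |u x| ≤ a * W x) → (∀ m : ℝ, 0 ≤ m → (∀ x, |u x| ≤ m * W x) → ∀ x, |u x| ≤ (μ * m + D) * W x) → ∀ x, |u x| ≤ D / (1 - μ) * W x := by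
  intro X u W μ D a hμ hW hap H x₀
  have hbdd : BddAbove (Set.range fun x => |u x| / W x) :=
    ⟨a, by rintro _ ⟨x, rfl⟩; rw [div_le_iff₀ (hW x)]; exact hap x⟩
  set m : ℝ := sSup (Set.range fun x => |u x| / W x) with hm
  have hle : ∀ x, |u x| / W x ≤ m := fun x => le_csSup hbdd ⟨x, rfl⟩
  have hm0 : 0 ≤ m := (div_nonneg (abs_nonneg _) (hW x₀).le).trans (hle x₀)
  have hdom : ∀ x, |u x| ≤ m * W x := fun x => by
    have := hle x; rwa [div_le_iff₀ (hW x)] at this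
  have himp := H m hm0 hdom
  -- the self-improved domination bounds the supremum: `m ≤ μ m + D`
  have hm_le : m ≤ μ * m + D :=
    csSup_le ⟨_, ⟨x₀, rfl⟩⟩ (by rintro _ ⟨x, rfl⟩; rw [div_le_iff₀ (hW x)]; exact himp x)
  have hm2 : m ≤ D / (1 - μ) := by
    rw [le_div_iff₀ (by linarith)]; nlinarith
  exact (hdom x₀).trans (mul_le_mul_of_nonneg_right hm2 (hW x₀).le)

/-! ### `N → ∞` -/

/-- **Removing the truncation.** If `t ≤ C (w + w'/N)` for every real `N ≥ 1`, then `t ≤ C w`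
(let `N → ∞`: `C (w + w' N⁻¹) → C w`). No sign conditions. [folklore] -/
theorem le_mul_of_forall_le_mul_add_div {t C w w' : ℝ} (h : ∀ N : ℝ, 1 ≤ N → t ≤ C * (w + w' / N)) :
    t ≤ C * w := by
  have ht : Tendsto (fun N : ℝ => C * (w + w' * N⁻¹)) atTop (𝓝 (C * (w + w' * 0))) :=
    tendsto_const_nhds.mul (tendsto_const_nhds.add (tendsto_inv_atTop_zero.const_mul _))
  rw [mul_zero, add_zero] at ht
  refine ge_of_tendsto ht ?_
  filter_upwards [eventually_ge_atTop (1 : ℝ)] with N hN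
  simpa only [div_eq_mul_inv] using h N hN

/-! ### Two weights: truncation and `N → ∞` -/

/-- **Weighted sup-norm absorption with a truncated weight, `N → ∞`** (FF5, registered helper; the
shape FF6 consumes). Data: a far set `S`, `u : X → ℝ`, a target weight `W ≥ 0` and an a-priori weight
`W' > 0`, constants `0 ≤ μ < 1`, `0 ≤ D`, `B`, `a`. Hypotheses: the a-priori bound `|u| ≤ a W'`; the
near-field bound `|u x| ≤ B W x` for `x ∉ S`; and, for every truncation level `N ≥ 1` and every `m ≥ 0`,
the FAR-FIELD SELF-IMPROVEMENT for the truncated weight `W_N := W + W'/N`: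
`(∀ x, |u x| ≤ m W_N x) → ∀ x ∈ S, |u x| ≤ (μ m + D) W_N x`. Conclusion:
**`|u x| ≤ max D B / (1 - μ) · W x` for every `x`.** Proof: for fixed `N`, `W_N > 0`,
`|u| ≤ |a| N · W_N`, and the improvement holds on all of `X` with the constant `max D B`
(`B W ≤ max D B · W_N` off `S`), so `t12_abs_le_weight_of_selfImproving` gives
`|u| ≤ max D B / (1-μ) · (W + W'/N)` uniformly in `N`; let `N → ∞`. The additive truncation is what a
positive linear operator propagates (`𝒯(m W + (m/N) W') = m 𝒯W + (m/N) 𝒯W'`); for the tree's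
`max (W, W'/N)` see `abs_le_weight_of_maxTruncated_selfImproving`. Grad 1963 / Guo 2010 scheme,
`k`-step-ready (the improving map is a hypothesis, not an operator). [folklore] -/
theorem t12_abs_le_weight_of_truncated_selfImproving : ∀ {X : Type*} (S : Set X) (u W W' : X → ℝ) (μ D B a : ℝ), 0 ≤ μ → μ < 1 → 0 ≤ D → (∀ x, 0 ≤ W x) → (∀ x, 0 < W' x) → (∀ x, |u x| ≤ a * W' x) → (∀ x ∉ S, |u x| ≤ B * W x) → (∀ N : ℝ, 1 ≤ N → ∀ m : ℝ, 0 ≤ m → (∀ x, |u x| ≤ m * (W x + W' x / N)) → ∀ x ∈ S, |u x| ≤ (μ * m + D) * (W x + W' x / N)) → ∀ x, |u x| ≤ max D B / (1 - μ) * W x := by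
  intro X S u W W' μ D B a hμ0 hμ1 hD hW hW' hap hnear hfar x₀
  set C : ℝ := max D B / (1 - μ) with hC
  have hDB : 0 ≤ max D B := le_max_of_le_left hD
  -- the estimate with the truncated weight `W + W'/N`, uniformly in `N ≥ 1`
  have key : ∀ N : ℝ, 1 ≤ N → |u x₀| ≤ C * (W x₀ + W' x₀ / N) := by
    intro N hN
    have hN0 : 0 < N := by linarith
    have hWN : ∀ x, 0 < W x + W' x / N := fun x =>
      add_pos_of_nonneg_of_pos (hW x) (div_pos (hW' x) hN0)
    refine t12_abs_le_weight_of_selfImproving u (fun x => W x + W' x / N) μ (max D B) (|a| * N)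
      hμ1 hWN ?_ ?_ x₀
    · -- a-priori: `|u| ≤ a W' ≤ |a| N (W + W'/N)`
      intro x
      calc |u x| ≤ a * W' x := hap x
        _ ≤ |a| * W' x := mul_le_mul_of_nonneg_right (le_abs_self a) (hW' x).le
        _ = |a| * N * (W' x / N) := by field_simp
        _ ≤ |a| * N * (W x + W' x / N) :=
          mul_le_mul_of_nonneg_left (le_add_of_nonneg_left (hW x)) (by positivity)
    · -- self-improvement on all of `X` with the constant `max D B`
      intro m hm hdom x
      by_cases hx : x ∈ S
      · exact (hfar N hN m hm hdom x hx).trans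
          (mul_le_mul_of_nonneg_right (add_le_add le_rfl (le_max_left _ _)) (hWN x).le)
      · calc |u x| ≤ B * W x := hnear x hx
          _ ≤ max D B * W x := mul_le_mul_of_nonneg_right (le_max_right _ _) (hW x)
          _ ≤ max D B * (W x + W' x / N) :=
            mul_le_mul_of_nonneg_left (le_add_of_nonneg_right (div_pos (hW' x) hN0).le) hDB
          _ ≤ (μ * m + max D B) * (W x + W' x / N) :=
            mul_le_mul_of_nonneg_right (le_add_of_nonneg_left (mul_nonneg hμ0 hm)) (hWN x).le
  -- `N → ∞`
  exact le_mul_of_forall_le_mul_add_div key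

/-- **The same with the tree's `max` truncation** `W_N := max (W, W'/N)` (the literal shape of
`LinearizedBoltzmannQuarticAbsorption` / `exists_abs_le_mul_quartic_of_fixedPoint`): far set `S`,
`W ≥ 0`, `W' > 0`, `0 ≤ μ < 1`, `0 ≤ D`; a-priori `|u| ≤ a W'`, near field `|u x| ≤ B W x` off `S`, and
for all `N ≥ 1`, `m ≥ 0` the far-field improvement
`(∀ x, |u x| ≤ m · max (W x) (W' x / N)) → ∀ x ∈ S, |u x| ≤ (μ m + D) · max (W x) (W' x / N)`; then
`|u x| ≤ max D B / (1 - μ) · W x` everywhere (`t12_abs_le_weight_of_selfImproving` at fixed `N`, then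
`max (W, W'/N) ≤ W + W'/N → W`). [folklore] -/
theorem abs_le_weight_of_maxTruncated_selfImproving {X : Type*} (S : Set X) (u W W' : X → ℝ)
    {μ D B a : ℝ} (hμ0 : 0 ≤ μ) (hμ1 : μ < 1) (hD : 0 ≤ D) (hW : ∀ x, 0 ≤ W x) (hW' : ∀ x, 0 < W' x)
    (hap : ∀ x, |u x| ≤ a * W' x) (hnear : ∀ x ∉ S, |u x| ≤ B * W x)
    (hfar : ∀ N : ℝ, 1 ≤ N → ∀ m : ℝ, 0 ≤ m → (∀ x, |u x| ≤ m * max (W x) (W' x / N)) →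
      ∀ x ∈ S, |u x| ≤ (μ * m + D) * max (W x) (W' x / N)) :
    ∀ x, |u x| ≤ max D B / (1 - μ) * W x := by
  intro x₀
  set C : ℝ := max D B / (1 - μ) with hC
  have hDB : 0 ≤ max D B := le_max_of_le_left hD
  have hC0 : 0 ≤ C := div_nonneg hDB (by linarith)
  -- the estimate with the truncated weight `max (W, W'/N)`, uniformly in `N ≥ 1`
  have key : ∀ N : ℝ, 1 ≤ N → |u x₀| ≤ C * max (W x₀) (W' x₀ / N) := by
    intro N hN
    have hN0 : 0 < N := by linarith
    have hWN : ∀ x, 0 < max (W x) (W' x / N) := fun x => lt_max_of_lt_right (div_pos (hW' x) hN0)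
    refine t12_abs_le_weight_of_selfImproving u (fun x => max (W x) (W' x / N)) μ (max D B) (|a| * N)
      hμ1 hWN ?_ ?_ x₀
    · intro x
      calc |u x| ≤ a * W' x := hap x
        _ ≤ |a| * W' x := mul_le_mul_of_nonneg_right (le_abs_self a) (hW' x).le
        _ = |a| * N * (W' x / N) := by field_simp
        _ ≤ |a| * N * max (W x) (W' x / N) := mul_le_mul_of_nonneg_left (le_max_right _ _) (by positivity)
    · intro m hm hdom x
      by_cases hx : x ∈ S
      · exact (hfar N hN m hm hdom x hx).trans
          (mul_le_mul_of_nonneg_right (add_le_add le_rfl (le_max_left _ _)) (hWN x).le)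
      · calc |u x| ≤ B * W x := hnear x hx
          _ ≤ max D B * W x := mul_le_mul_of_nonneg_right (le_max_right _ _) (hW x)
          _ ≤ max D B * max (W x) (W' x / N) := mul_le_mul_of_nonneg_left (le_max_left _ _) hDB
          _ ≤ (μ * m + max D B) * max (W x) (W' x / N) :=
            mul_le_mul_of_nonneg_right (le_add_of_nonneg_left (mul_nonneg hμ0 hm)) (hWN x).le
  -- `N → ∞` through `max (W, W'/N) ≤ W + W'/N`
  refine le_mul_of_forall_le_mul_add_div (w' := W' x₀) fun N hN =>
    (key N hN).trans (mul_le_mul_of_nonneg_left ?_ hC0)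
  have hN0 : 0 < N := by linarith
  exact max_le (le_add_of_nonneg_right (div_pos (hW' x₀) hN0).le) (le_add_of_nonneg_left (hW x₀))

end Summit.AtomisticToContinuum.HydrodynamicLimit.Theorems.ClampedCorrectorBirth
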